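import Literature.NumberTheory.Automorphic.ArchKirillovMirabolicRep
import Literature.NumberTheory.Automorphic.ArchCharFourierUniqueness
import Mathlib.MeasureTheory.Integral.Lebesgue.Countable
import Mathlib.MeasureTheory.Function.L2Space
import HarnessLib

/-!
# The Kirillov representation of `P₂(K_∞)` on `L²(K_∞ˣ)` has trivial commutant (Schur property)

Topic `NumberTheory/Automorphic`; namespace `Literature.NumberTheory.Automorphic`. Theorems only (no
definition, no named fact). For `K_∞ = mixedSpace K`, a Haar measure `μ` on `K_∞ˣ` and the Kirillov
representation `ρ = kirillovRep μ` of the mirabolic `P₂(K_∞)` on `L²(K_∞ˣ, μ)`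
(`(ρ(p) f)(u) = ψ_∞(u p₀₁) f(u p₀₀)`, `ArchKirillovMirabolicRep`):

* `ae_eq_mul_of_commute_kirillovMulChar` — **an operator commuting with all multiplications by the
  characters `u ↦ ψ_∞(u x)` is a multiplication operator**: `T f = m · f` a.e. for one measurable `m`.
  Proof: `⟪M_{-x} f, T† g⟫ = ⟪M_{-x} T f, g⟫` says that `F = f̄ · T†g - (Tf)‾ · g ∈ L¹` has all
  character integrals `∫ ψ_∞(u x) F(u) dμ = 0`, hence vanishes (`ArchCharFourierUniqueness`); with `g`
  a fixed everywhere positive `ρ₀ ∈ L²` this gives `T f = m f`, `m = (T† ρ₀)‾ / ρ₀`.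
* `exists_eq_smul_of_commute_kirillov` — **if `T` also commutes with the dilations `f ↦ f(· y)`,
  then `T = c · 1`**: `m(u y) = m(u)` a.e. for every `y`, so by Fubini `m` is a.e. constant.
* `kirillovRep_schur` — **Schur property of `kirillovRep μ`**: a bounded operator on `L²(K_∞ˣ)`
  commuting with every `ρ(p)` is a scalar (commute with `ρ(n(x))`, `ρ(diag(y, 1))`). This is the
  irreducibility of `τ₂ = Ind_{N₂}^{P₂} θ` (Jacquet–Shalika (1981), (3.5): "`τ_r` is irreducible";
  Kirillov (1962)) in the form consumed by the closability route
  (`HilbertRepSchurGraphTwo.exists_norm_snd_le_of_invariant_of_schur`).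

## References

* H. Jacquet, J. A. Shalika, *On Euler products and the classification of automorphic
  representations I*, Amer. J. Math. 103 (1981), §3, (3.5) [JacquetShalikaAJM1981].
* G. B. Folland, *A Course in Abstract Harmonic Analysis* (1995), §6.4–6.5 (systems of
  imprimitivity; irreducibility of induced representations) [Folland1995].
-/

noncomputable section

open scoped Classical Real ENNReal NNReal MatrixGroups ComplexConjugate InnerProductSpace
open NumberField NumberField.mixedEmbedding NumberField.InfinitePlace MeasureTheory Complex Filter

namespace Literature.NumberTheory.Automorphic

variable {K : Type} [Field K] [NumberField K]
variable [MeasurableSpace ((mixedSpace K)ˣ)] [BorelSpace ((mixedSpace K)ˣ)]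

/-! ### 1. Commuting with the character multiplications: `T` is a multiplication operator -/

section MulChar

variable (μ : Measure ((mixedSpace K)ˣ))

omit [NumberField K] [BorelSpace ((mixedSpace K)ˣ)] in
/-- The `L²` inner product on `K_∞ˣ` written out: `⟪f, g⟫ = ∫ conj(f u) g(u) dμ`. [folklore] -/
theorem inner_Lp_eq_integral (f g : Lp ℂ 2 μ) : ⟪f, g⟫_ℂ = ∫ u, conj (f u) * g u ∂μ := by
  rw [L2.inner_def]
  exact integral_congr_ae (Eventually.of_forall fun u => by simp only [RCLike.inner_apply, mul_comm])

/-- **The character integrals of `f̄ T†g - (Tf)‾ g` vanish** when `T` commutes with the multiplications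
`M_x` by `u ↦ ψ_∞(u x)`: `⟪M_{-x} f, T† g⟫ = ⟪T M_{-x} f, g⟫ = ⟪M_{-x} T f, g⟫`. [folklore] -/
theorem integral_archChar_mul_eq_zero_of_commute [μ.IsMulLeftInvariant] (T : Lp ℂ 2 μ →L[ℂ] Lp ℂ 2 μ)
    (hM : ∀ x : mixedSpace K, ∀ f : Lp ℂ 2 μ, T (kirillovMulChar μ x f) = kirillovMulChar μ x (T f))
    (f g : Lp ℂ 2 μ) (x : mixedSpace K) :
    ∫ u, archChar K (u : mixedSpace K) x *
        (conj (f u) * (ContinuousLinearMap.adjoint T g) u - conj ((T f) u) * g u) ∂μ = 0 := by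
  have hint1 : Integrable (fun u => conj (f u) * (ContinuousLinearMap.adjoint T g) u) μ := by
    simpa only [RCLike.inner_apply, mul_comm] using L2.integrable_inner (𝕜 := ℂ) f (ContinuousLinearMap.adjoint T g)
  have hint2 : Integrable (fun u => conj ((T f) u) * g u) μ := by
    simpa only [RCLike.inner_apply, mul_comm] using L2.integrable_inner (𝕜 := ℂ) (T f) g
  -- `⟪M_{-x} f, T† g⟫ = ⟪M_{-x} (T f), g⟫`
  have key : ⟪kirillovMulChar μ (-x) f, ContinuousLinearMap.adjoint T g⟫_ℂ = ⟪kirillovMulChar μ (-x) (T f), g⟫_ℂ := by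
    rw [ContinuousLinearMap.adjoint_inner_right, hM]
  rw [inner_Lp_eq_integral, inner_Lp_eq_integral] at key
  have e1 : ∫ u, conj ((kirillovMulChar μ (-x) f) u) * (ContinuousLinearMap.adjoint T g) u ∂μ =
      ∫ u, archChar K (u : mixedSpace K) x * (conj (f u) * (ContinuousLinearMap.adjoint T g) u) ∂μ := by
    refine integral_congr_ae ?_
    filter_upwards [coeFn_kirillovMulChar μ (-x) f] with u hu
    rw [hu, map_mul, conj_archChar, neg_neg, mul_assoc]
  have e2 : ∫ u, conj ((kirillovMulChar μ (-x) (T f)) u) * g u ∂μ =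
      ∫ u, archChar K (u : mixedSpace K) x * (conj ((T f) u) * g u) ∂μ := by
    refine integral_congr_ae ?_
    filter_upwards [coeFn_kirillovMulChar μ (-x) (T f)] with u hu
    rw [hu, map_mul, conj_archChar, neg_neg, mul_assoc]
  rw [e1, e2] at key
  simp_rw [mul_sub]
  rw [integral_sub (integrable_archChar_mul hint1 x) (integrable_archChar_mul hint2 x), key, sub_self]

/-- **Pointwise form of the commutation**: `conj(f) · T†g = conj(T f) · g` a.e., for all `f, g ∈ L²`
(Fourier uniqueness, `ae_eq_zero_of_forall_integral_archChar_mul`). [folklore] -/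
theorem ae_conj_mul_adjoint_eq [μ.IsMulLeftInvariant] (T : Lp ℂ 2 μ →L[ℂ] Lp ℂ 2 μ)
    (hM : ∀ x : mixedSpace K, ∀ f : Lp ℂ 2 μ, T (kirillovMulChar μ x f) = kirillovMulChar μ x (T f))
    (f g : Lp ℂ 2 μ) :
    ∀ᵐ u ∂μ, conj (f u) * (ContinuousLinearMap.adjoint T g) u = conj ((T f) u) * g u := by
  have hint1 : Integrable (fun u => conj (f u) * (ContinuousLinearMap.adjoint T g) u) μ := by
    simpa only [RCLike.inner_apply, mul_comm] using L2.integrable_inner (𝕜 := ℂ) f (ContinuousLinearMap.adjoint T g)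
  have hint2 : Integrable (fun u => conj ((T f) u) * g u) μ := by
    simpa only [RCLike.inner_apply, mul_comm] using L2.integrable_inner (𝕜 := ℂ) (T f) g
  have hF : Integrable (fun u => conj (f u) * (ContinuousLinearMap.adjoint T g) u - conj ((T f) u) * g u) μ :=
    hint1.sub hint2
  have h0 := ae_eq_zero_of_forall_integral_archChar_mul μ hF (integral_archChar_mul_eq_zero_of_commute μ T hM f g)
  filter_upwards [h0] with u hu
  exact sub_eq_zero.1 hu

omit [NumberField K] [BorelSpace ((mixedSpace K)ˣ)] in
/-- **An everywhere positive `L²` function on `K_∞ˣ`** (`μ` σ-finite): `ρ₀ = min(g, 1)` for a positive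
measurable `g` of finite integral. [folklore] -/
theorem exists_pos_memLp_two [SigmaFinite μ] :
    ∃ ρ₀ : (mixedSpace K)ˣ → ℝ, (∀ u, 0 < ρ₀ u) ∧ Measurable ρ₀ ∧ MemLp ρ₀ 2 μ := by
  obtain ⟨g, hgpos, hgm, hgint⟩ := exists_pos_lintegral_lt_of_sigmaFinite μ one_ne_zero
  refine ⟨fun u => min (g u : ℝ) 1, fun u => lt_min (by exact_mod_cast hgpos u) one_pos,
    (measurable_coe_nnreal_real.comp hgm).min measurable_const, ?_⟩
  have hmeas : AEStronglyMeasurable (fun u => min (g u : ℝ) 1) μ :=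
    ((measurable_coe_nnreal_real.comp hgm).min measurable_const).aestronglyMeasurable
  rw [memLp_two_iff_integrable_sq hmeas]
  have hgI : Integrable (fun u => ((g u : ℝ≥0∞)).toReal) μ :=
    integrable_toReal_of_lintegral_ne_top hgm.coe_nnreal_ennreal.aemeasurable (ne_top_of_lt hgint)
  refine hgI.mono (hmeas.pow 2) (Filter.Eventually.of_forall fun u => ?_)
  have h0 : 0 ≤ min (g u : ℝ) 1 := le_min (NNReal.coe_nonneg _) zero_le_one
  have h1 : min (g u : ℝ) 1 ≤ 1 := min_le_right _ _
  have h2 : min (g u : ℝ) 1 ≤ (g u : ℝ) := min_le_left _ _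
  rw [Real.norm_eq_abs, abs_of_nonneg (sq_nonneg _), Real.norm_eq_abs, ENNReal.coe_toReal,
    abs_of_nonneg (NNReal.coe_nonneg _), sq]
  calc min (g u : ℝ) 1 * min (g u : ℝ) 1 ≤ 1 * min (g u : ℝ) 1 := by gcongr
    _ ≤ (g u : ℝ) := by rw [one_mul]; exact h2

/-- **An operator on `L²(K_∞ˣ)` commuting with all character multiplications is a multiplication
operator**: `T f = m f` a.e. for one measurable `m` (namely `m = (T† ρ₀)‾/ρ₀` for an everywhere
positive `ρ₀ ∈ L²`). [folklore] -/
theorem ae_eq_mul_of_commute_kirillovMulChar [μ.IsMulLeftInvariant] [SigmaFinite μ] (T : Lp ℂ 2 μ →L[ℂ] Lp ℂ 2 μ)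
    (hM : ∀ x : mixedSpace K, ∀ f : Lp ℂ 2 μ, T (kirillovMulChar μ x f) = kirillovMulChar μ x (T f)) :
    ∃ m : (mixedSpace K)ˣ → ℂ, Measurable m ∧ ∀ f : Lp ℂ 2 μ, (T f : (mixedSpace K)ˣ → ℂ) =ᵐ[μ] fun u => m u * f u := by
  obtain ⟨ρ₀, hρpos, hρm, hρ2⟩ := exists_pos_memLp_two μ
  have hρ2c : MemLp (fun u => (ρ₀ u : ℂ)) 2 μ := hρ2.ofReal
  set r : Lp ℂ 2 μ := hρ2c.toLp _ with hr
  have hr_ae : (r : (mixedSpace K)ˣ → ℂ) =ᵐ[μ] fun u => (ρ₀ u : ℂ) := MemLp.coeFn_toLp _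
  have hhm : Measurable (ContinuousLinearMap.adjoint T r : (mixedSpace K)ˣ → ℂ) := (Lp.stronglyMeasurable _).measurable
  refine ⟨fun u => conj ((ContinuousLinearMap.adjoint T r : (mixedSpace K)ˣ → ℂ) u) / (ρ₀ u : ℂ),
    (Complex.continuous_conj.measurable.comp hhm).div (Complex.measurable_ofReal.comp hρm), fun f => ?_⟩
  filter_upwards [ae_conj_mul_adjoint_eq μ T hM f r, hr_ae] with u hu hru
  rw [hru] at hu
  -- `conj(f u) · h u = conj(Tf u) · ρ₀ u` gives `Tf u = conj(h u)/ρ₀ u · f u`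
  have hρ0 : (ρ₀ u : ℂ) ≠ 0 := by exact_mod_cast (hρpos u).ne'
  have hu' : f u * conj ((ContinuousLinearMap.adjoint T r : (mixedSpace K)ˣ → ℂ) u) =
      (T f : (mixedSpace K)ˣ → ℂ) u * (ρ₀ u : ℂ) := by
    have h := congrArg conj hu
    simpa only [map_mul, Complex.conj_conj, Complex.conj_ofReal] using h
  rw [div_mul_eq_mul_div, eq_div_iff hρ0, ← hu', mul_comm]

end MulChar

/-! ### 2. Adding the dilations: `T` is a scalar -/

section Dilation

variable (μ : Measure ((mixedSpace K)ˣ))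

/-- **A measurable function on `K_∞ˣ` invariant a.e. under every translation is a.e. constant**
(`μ` a Haar measure): by Fubini the set `{(u, y) | m(uy) ≠ m(u)}` is null, so for some `u₀`,
`m(u₀ y) = m(u₀)` for a.e. `y`, and `y ↦ u₀ y` preserves `μ`. [folklore] -/
theorem exists_ae_eq_const_of_forall_ae_mul_eq [μ.IsHaarMeasure] {m : (mixedSpace K)ˣ → ℂ} (hm : Measurable m)
    (hinv : ∀ y : (mixedSpace K)ˣ, ∀ᵐ u ∂μ, m (u * y) = m u) :
    ∃ c : ℂ, ∀ᵐ u ∂μ, m u = c := by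
  by_cases hμ : μ = 0
  · exact ⟨0, by rw [hμ]; exact ae_zero.le (by simp)⟩
  haveI : (ae μ).NeBot := ae_neBot.2 hμ
  -- Fubini: for a.e. `u`, for a.e. `y`, `m (u * y) = m u`
  have hset : MeasurableSet {p : (mixedSpace K)ˣ × (mixedSpace K)ˣ | m (p.1 * p.2) = m p.1} :=
    measurableSet_eq_fun (hm.comp measurable_mul) (hm.comp measurable_fst)
  have h1 : ∀ᵐ y ∂μ, ∀ᵐ u ∂μ, m (u * y) = m u := Filter.Eventually.of_forall hinv
  have h2 : ∀ᵐ u ∂μ, ∀ᵐ y ∂μ, m (u * y) = m u :=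
    (Measure.ae_ae_comm (μ := μ) (ν := μ) (p := fun u y => m (u * y) = m u) hset).2 h1
  obtain ⟨u₀, hu₀⟩ := h2.exists
  refine ⟨m u₀, ?_⟩
  -- transport along the measure-preserving `y ↦ u₀ y`
  have hmp : MeasurePreserving (fun y : (mixedSpace K)ˣ => u₀ * y) μ μ := measurePreserving_mul_left μ u₀
  have hmeas : MeasurableSet {z : (mixedSpace K)ˣ | m z = m u₀} := hm (measurableSet_singleton _)
  have h3 : ∀ᵐ z ∂(μ.map fun y : (mixedSpace K)ˣ => u₀ * y), m z = m u₀ :=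
    (ae_map_iff hmp.measurable.aemeasurable hmeas).2 hu₀
  rwa [hmp.map_eq] at h3

/-- **An operator on `L²(K_∞ˣ)` commuting with all character multiplications and all dilations is a
scalar** (`T = M_m` with `m` translation invariant a.e., hence constant). [folklore] -/
theorem exists_eq_smul_of_commute_kirillov [μ.IsHaarMeasure] (T : Lp ℂ 2 μ →L[ℂ] Lp ℂ 2 μ)
    (hM : ∀ x : mixedSpace K, ∀ f : Lp ℂ 2 μ, T (kirillovMulChar μ x f) = kirillovMulChar μ x (T f))
    (hD : ∀ y : (mixedSpace K)ˣ, ∀ f : Lp ℂ 2 μ, T (kirillovDilation μ y f) = kirillovDilation μ y (T f)) :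
    ∃ c : ℂ, ∀ f : Lp ℂ 2 μ, T f = c • f := by
  obtain ⟨m, hm, hTm⟩ := ae_eq_mul_of_commute_kirillovMulChar μ T hM
  obtain ⟨ρ₀, hρpos, hρm, hρ2⟩ := exists_pos_memLp_two μ
  have hρ2c : MemLp (fun u => (ρ₀ u : ℂ)) 2 μ := hρ2.ofReal
  set r : Lp ℂ 2 μ := hρ2c.toLp _ with hr
  have hr_ae : (r : (mixedSpace K)ˣ → ℂ) =ᵐ[μ] fun u => (ρ₀ u : ℂ) := MemLp.coeFn_toLp _
  -- `m` is translation invariant a.e.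
  have hinv : ∀ y : (mixedSpace K)ˣ, ∀ᵐ u ∂μ, m (u * y) = m u := by
    intro y
    have hqmp := (measurePreserving_mul_right μ y).quasiMeasurePreserving
    -- `T (D_y r)` computed in two ways
    have hL : (T (kirillovDilation μ y r) : (mixedSpace K)ˣ → ℂ) =ᵐ[μ] fun u => m u * (ρ₀ (u * y) : ℂ) := by
      filter_upwards [hTm (kirillovDilation μ y r), coeFn_kirillovDilation μ y r, hqmp.ae_eq_comp hr_ae] with u h1 h2 h3
      rw [h1, h2]
      exact congrArg (fun z => m u * z) h3
    have hR : (kirillovDilation μ y (T r) : (mixedSpace K)ˣ → ℂ) =ᵐ[μ] fun u => m (u * y) * (ρ₀ (u * y) : ℂ) := by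
      have hc : (fun u => (T r : (mixedSpace K)ˣ → ℂ) (u * y)) =ᵐ[μ] fun u => m (u * y) * (r : (mixedSpace K)ˣ → ℂ) (u * y) :=
        hqmp.ae_eq_comp (hTm r)
      filter_upwards [coeFn_kirillovDilation μ y (T r), hc, hqmp.ae_eq_comp hr_ae] with u h1 h2 h3
      rw [h1, h2]
      exact congrArg (fun z => m (u * y) * z) h3
    have heq : (T (kirillovDilation μ y r) : (mixedSpace K)ˣ → ℂ) =ᵐ[μ] (kirillovDilation μ y (T r) : (mixedSpace K)ˣ → ℂ) := by
      rw [hD y r]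
    filter_upwards [hL, hR, heq] with u h1 h2 h3
    rw [h1, h2] at h3
    have hρ0 : (ρ₀ (u * y) : ℂ) ≠ 0 := by exact_mod_cast (hρpos (u * y)).ne'
    exact (mul_right_cancel₀ hρ0 h3).symm
  obtain ⟨c, hc⟩ := exists_ae_eq_const_of_forall_ae_mul_eq μ hm hinv
  refine ⟨c, fun f => Lp.ext ?_⟩
  filter_upwards [hTm f, hc, Lp.coeFn_smul c f] with u h1 h2 h3
  rw [h1, h2, h3, Pi.smul_apply, smul_eq_mul]

end Dilation

/-! ### 3. The Schur property of the Kirillov representation -/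

section Schur

variable (μ : Measure ((mixedSpace K)ˣ))

omit [NumberField K] [MeasurableSpace ((mixedSpace K)ˣ)] [BorelSpace ((mixedSpace K)ˣ)] in
/-- The unipotent `n(x) = (1 x; 0 1)` as an element of the mirabolic subgroup. [folklore] -/
theorem unipotentGL2_mem_mirabolicTwo (x : mixedSpace K) :
    ((unipotentGL2 x : ↥(upperUnitriangular (Fin 2) (mixedSpace K))) : GL (Fin 2) (mixedSpace K)) ∈ mirabolicTwo K := by
  rw [mem_mirabolicTwo_iff, coe_unipotentGL2]
  constructor <;> simp

omit [NumberField K] [MeasurableSpace ((mixedSpace K)ˣ)] [BorelSpace ((mixedSpace K)ˣ)] in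
/-- The diagonal `diag(y, 1)` as an element of the mirabolic subgroup. [folklore] -/
theorem diagGL2_mem_mirabolicTwo (y : (mixedSpace K)ˣ) : (diagGL2 y 1 : GL (Fin 2) (mixedSpace K)) ∈ mirabolicTwo K := by
  rw [mem_mirabolicTwo_iff, coe_diagGL2]
  constructor <;> simp

/-- `ρ(n(x)) = M_x`. [folklore] -/
theorem kirillovRep_unipotent [μ.IsMulLeftInvariant] (x : mixedSpace K) (f : Lp ℂ 2 μ) :
    kirillovRep μ ⟨_, unipotentGL2_mem_mirabolicTwo x⟩ f = kirillovMulChar μ x f := by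
  rw [kirillovRep_apply]
  have h1 : mirabolicFst (⟨_, unipotentGL2_mem_mirabolicTwo x⟩ : mirabolicTwo K) = 1 := by
    refine Units.ext ?_
    rw [coe_mirabolicFst, coe_unipotentGL2]
    simp
  have h2 : ((((unipotentGL2 x : ↥(upperUnitriangular (Fin 2) (mixedSpace K))) : GL (Fin 2) (mixedSpace K)) :
      Matrix (Fin 2) (Fin 2) (mixedSpace K)) 0 1) = x := unipotentGL2_apply_zero_one x
  rw [h1]
  change kirillovMulChar μ ((((unipotentGL2 x : ↥(upperUnitriangular (Fin 2) (mixedSpace K))) :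
    GL (Fin 2) (mixedSpace K)) : Matrix (Fin 2) (Fin 2) (mixedSpace K)) 0 1) (kirillovDilation μ 1 f) = _
  rw [h2]
  congr 1
  refine Lp.ext ?_
  filter_upwards [coeFn_kirillovDilation μ 1 f] with u hu
  rw [hu, mul_one]

/-- `ρ(diag(y, 1)) = D_y`. [folklore] -/
theorem kirillovRep_diag [μ.IsMulLeftInvariant] (y : (mixedSpace K)ˣ) (f : Lp ℂ 2 μ) :
    kirillovRep μ ⟨_, diagGL2_mem_mirabolicTwo y⟩ f = kirillovDilation μ y f := by
  rw [kirillovRep_apply]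
  have h1 : mirabolicFst (⟨_, diagGL2_mem_mirabolicTwo y⟩ : mirabolicTwo K) = y := by
    refine Units.ext ?_
    rw [coe_mirabolicFst, coe_diagGL2]
    simp
  have h2 : (((diagGL2 y 1 : GL (Fin 2) (mixedSpace K)) : Matrix (Fin 2) (Fin 2) (mixedSpace K)) 0 1) = 0 := by
    rw [coe_diagGL2]; simp
  rw [h1]
  change kirillovMulChar μ (((diagGL2 y 1 : GL (Fin 2) (mixedSpace K)) : Matrix (Fin 2) (Fin 2) (mixedSpace K)) 0 1)
    (kirillovDilation μ y f) = _
  rw [h2]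
  refine Lp.ext ?_
  filter_upwards [coeFn_kirillovMulChar μ 0 (kirillovDilation μ y f)] with u hu
  rw [hu, archChar_zero_right, one_mul]

/-- **Schur property of the Kirillov representation of `P₂(K_∞)` on `L²(K_∞ˣ)`**: a bounded
operator commuting with every `ρ(p)` is a scalar. (Commuting with `ρ(n(x)) = M_x` makes it a
multiplication operator by Fourier uniqueness; commuting with `ρ(diag(y,1)) = D_y` makes the multiplier
translation invariant, hence constant.) This is the irreducibility of `τ₂ = Ind_{N₂}^{P₂} θ` realised on
`L²(N₂ \ P₂)` (Jacquet–Shalika (1981), (3.5)). [cite: JacquetShalikaAJM1981, §3, (3.5)] -/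
theorem kirillovRep_schur [μ.IsHaarMeasure] (T : Lp ℂ 2 μ →L[ℂ] Lp ℂ 2 μ)
    (hT : ∀ p : mirabolicTwo K, Commute (kirillovRep μ p) T) :
    ∃ c : ℂ, ∀ f : Lp ℂ 2 μ, T f = c • f := by
  refine exists_eq_smul_of_commute_kirillov μ T (fun x f => ?_) (fun y f => ?_)
  · have h := congrArg (fun S : Lp ℂ 2 μ →L[ℂ] Lp ℂ 2 μ => S f) (hT ⟨_, unipotentGL2_mem_mirabolicTwo x⟩).eq
    simp only [ContinuousLinearMap.mul_def, ContinuousLinearMap.coe_comp, Function.comp_apply] at h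
    change kirillovRep μ ⟨_, unipotentGL2_mem_mirabolicTwo x⟩ (T f) = T (kirillovRep μ ⟨_, unipotentGL2_mem_mirabolicTwo x⟩ f) at h
    rw [kirillovRep_unipotent, kirillovRep_unipotent] at h
    exact h.symm
  · have h := congrArg (fun S : Lp ℂ 2 μ →L[ℂ] Lp ℂ 2 μ => S f) (hT ⟨_, diagGL2_mem_mirabolicTwo y⟩).eq
    simp only [ContinuousLinearMap.mul_def, ContinuousLinearMap.coe_comp, Function.comp_apply] at h
    change kirillovRep μ ⟨_, diagGL2_mem_mirabolicTwo y⟩ (T f) = T (kirillovRep μ ⟨_, diagGL2_mem_mirabolicTwo y⟩ f) at h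
    rw [kirillovRep_diag, kirillovRep_diag] at h
    exact h.symm

end Schur

end Literature.NumberTheory.Automorphic
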